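import Mathlib.Algebra.Order.Field.Basic
import Mathlib.Tactic.Ring
import Mathlib.Tactic.Linarith
import Mathlib.Tactic.Positivity
import Summits.Ventures.CertifiedArithmetic.LowPrec.SRTreeEnvelopes
import HarnessLib

/-!
# Stochastic rounding into a finite format, X: removing the no-saturation hypothesis — the coupling

HONEST FRAMING: certified error envelopes and provably optimal rounding/accumulation schemes for
low-precision formats under stated cost models; every table by two implementations; no hardware or
vendor claims.

Every accumulation theorem of this series (mean, exact variance identity, `m·G²/4`, Chebyshev,
Azuma–Hoeffding, interval certificates; files II–IX) carries the hypothesis `NoSat`/`NoSatT`: on EVERY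
branch no pre-rounding value leaves the representable hull `[min F, max F]` (saturation is the exact
obstruction to unbiasedness, `SRStep.step_id_eq_self_iff`). This file and `SRSaturationTail`,
`SRSaturationFormats` replace that SURE hypothesis by a PROBABILITY: the saturating SR evaluation of a
summation tree in `F` is COUPLED with the evaluation in any refinement `F' ⊇ F` that agrees with `F`
on the hull of `F` (`Agrees F F'`; think of `F'` = `F` continued beyond `±max F` with the top spacing,
constructed in `SRSaturationFormats`), and the two evaluations coincide until the first node whose
pre-rounding value leaves the hull of `F`.

* `treeExpF F H T φ = E[φ(ŝ_T, flag_T)]` — the JOINT law of the root value and the flag "some node's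
  pre-rounding value left the hull of `H`" (rounding in `F`); `treeExpF_marg`: its first marginal is
  `treeExp F T`; linear, monotone;
* `treeExpF_restrict_eq` — **the coupling identity**: if `step F₁ c = step F₂ c` for every `c` in the
  hull of `H`, then `E_{F₁}[φ(ŝ_T); no flag] = E_{F₂}[φ(ŝ_T); no flag]` for EVERY tree and observable;
  `step_eq_of_agrees`: `Agrees H F'` gives exactly this for `(F₁, F₂) = (H, F')`;
* `satProbT F T` — the probability that the saturating SR evaluation of `T` in `F` saturates somewhere
  (some node's exact pre-rounding sum `a + b ∉ [min F, max F]`); `satProbT_eq_exitProb`: it equals the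
  exit probability of the `F'`-evaluation; `exitProb_le_satProb`: union bound by
  `satProb F' H T = ∑_{nodes} P_{F'}(a + b ∉ hull H)`, a sum of ordinary `treeExp` probabilities to which
  the envelopes of files V/VII apply (done in `SRSaturationTail`);
* law comparison `|E_F f(ŝ_T) − E_{F'} f(ŝ_T)| ≤ B · satProbT F T`, saturation bias and second moment, and
  the casts `ℚ → ℝ`: file `SRSaturationCompare`; the exponential bound on `satProb`: `SRSaturationTail`;
  the generic refinement `extendBy` and every-format corollaries: `SRExtension`, `SRSaturationFormats`.

No measure theory: all statements are exact identities/inequalities in an ordered field `K`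
(`K = ℚ`: kernel-evaluable). Placement: the SR literature excludes the range question ("x lies between
the smallest and largest finite value", El Arar–Fasi–Filip–Mikaitis survey arXiv:2603.06060 §2;
[ConnollyHighamMary2021] §2; arXiv:2607.18758 §8.2 lists bias in low-precision sums as a limitation);
a quantitative saturation probability for SR accumulation is, as far as our searches go (cell
FRESHNESS-SR.md), not in print. The coupling/first-exit argument itself is textbook probability.
-/

namespace Summit.Ventures.CertifiedArithmetic.LowPrec.SR

open Literature.ComputerArithmetic.ConnollyHighamMary2021
open Finset STree

section Agreement

variable {K : Type*} [LinearOrder K]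

/-! ### Refinements that agree on the hull -/

/-- `Agrees F F'`: `F ⊆ F'` and `F'` has no NEW point inside the hull of `F`. -/
structure Agrees (F F' : Finset K) : Prop where
  /-- the refinement contains the format -/
  subset : F ⊆ F'
  /-- no new point inside the hull -/
  mem_of_inHull : ∀ y ∈ F', InHull F y → y ∈ F

/-- Every format agrees with itself. -/
theorem Agrees.refl (F : Finset K) : Agrees F F := ⟨subset_rfl, fun _ hy _ => hy⟩

/-- A point of the hull of `F` is in the hull of `F'`. -/
theorem inHull_of_agrees {F F' : Finset K} (hA : Agrees F F') {c : K} (hc : InHull F c) :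
    InHull F' c := by
  obtain ⟨⟨y, hy, hyc⟩, ⟨z, hz, hcz⟩⟩ := hc
  exact ⟨⟨y, hA.subset hy, hyc⟩, ⟨z, hA.subset hz, hcz⟩⟩

/-- On the hull of `F`, the lower candidates in `F` and `F'` coincide. -/
theorem roundDown_eq_of_agrees {F F' : Finset K} (hA : Agrees F F') {c : K} (hc : InHull F c) :
    roundDown F' c = roundDown F c := by
  have hdF : roundDown F c ∈ F := roundDown_mem hc.1
  have h1 : roundDown F c ≤ roundDown F' c := le_roundDown_of_mem (hA.subset hdF) (roundDown_le F c)
  have hdF' : roundDown F' c ∈ F' := roundDown_mem (inHull_of_agrees hA hc).1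
  obtain ⟨z, hz, hcz⟩ := hc.2
  have hin : InHull F (roundDown F' c) := ⟨⟨_, hdF, h1⟩, ⟨z, hz, (roundDown_le F' c).trans hcz⟩⟩
  exact le_antisymm (le_roundDown_of_mem (hA.mem_of_inHull _ hdF' hin) (roundDown_le F' c)) h1

/-- On the hull of `F`, the upper candidates in `F` and `F'` coincide. -/
theorem roundUp_eq_of_agrees {F F' : Finset K} (hA : Agrees F F') {c : K} (hc : InHull F c) :
    roundUp F' c = roundUp F c := by
  have huF : roundUp F c ∈ F := roundUp_mem hc.2
  have h1 : roundUp F' c ≤ roundUp F c := roundUp_le_of_mem (hA.subset huF) (le_roundUp F c)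
  have huF' : roundUp F' c ∈ F' := roundUp_mem (inHull_of_agrees hA hc).2
  obtain ⟨y, hy, hyc⟩ := hc.1
  have hin : InHull F (roundUp F' c) := ⟨⟨y, hy, hyc.trans (le_roundUp F' c)⟩, ⟨_, huF, h1⟩⟩
  exact le_antisymm h1 (roundUp_le_of_mem (hA.mem_of_inHull _ huF' hin) (le_roundUp F' c))

/-- On the hull of `F`, clamping into `F'` is the identity as well. -/
theorem clamp_eq_of_agrees {F F' : Finset K} (hA : Agrees F F') {c : K} (hc : InHull F c) :
    clamp F' c = clamp F c := by
  rw [clamp_eq_self hc, clamp_eq_self (inHull_of_agrees hA hc)]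

end Agreement

variable {K : Type*} [Field K] [LinearOrder K] [IsStrictOrderedRing K]

omit [IsStrictOrderedRing K] in
/-- **On the hull of `F` one SR step into `F'` IS the SR step into `F`** (same candidates, same
probability): the two evaluations can only part at a pre-rounding value outside the hull of `F`. -/
theorem step_eq_of_agrees {F F' : Finset K} (hA : Agrees F F') {c : K} (hc : InHull F c)
    (f : K → K) : step F' c f = step F c f := by
  unfold step pUp up dn
  rw [clamp_eq_of_agrees hA hc, clamp_eq_self hc, roundUp_eq_of_agrees hA hc,
    roundDown_eq_of_agrees hA hc, probUp, probUp, roundUp_eq_of_agrees hA hc,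
    roundDown_eq_of_agrees hA hc]

/-! ### The joint law of the root value and the exit flag -/

omit [Field K] [IsStrictOrderedRing K] in
/-- Boolean "`c` lies OUTSIDE the hull of `H`". -/
def outB (H : Finset K) (c : K) : Bool := !decide (InHull H c)

omit [Field K] [IsStrictOrderedRing K] in
/-- `outB` is `false` exactly on the hull. -/
theorem outB_eq_false_iff (H : Finset K) (c : K) : outB H c = false ↔ InHull H c := by
  simp [outB]

omit [Field K] [IsStrictOrderedRing K] in
/-- `outB` is `true` exactly off the hull. -/
theorem outB_eq_true_iff (H : Finset K) (c : K) : outB H c = true ↔ ¬ InHull H c := by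
  simp [outB]

/-- `treeExpF F H T φ = E[φ(ŝ_T, flag_T)]`: SR evaluation of `T` with roundings in `F` (as `treeExp`),
carrying the flag "on the realised branch some node's pre-rounding value `a + b` was outside the hull of
`H`". For `H = F` the flag is exactly "some rounding saturated". -/
def treeExpF (F H : Finset K) : STree K → (K → Bool → K) → K
  | .leaf x, φ => φ x false
  | .node l r, φ => treeExpF F H l (fun a fa => treeExpF F H r (fun b fb =>
      step F (a + b) (fun v => φ v (fa || fb || outB H (a + b)))))

omit [IsStrictOrderedRing K] in
/-- `treeExpF` respects pointwise equality of integrands. -/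
theorem treeExpF_congr (F H : Finset K) (T : STree K) {φ ψ : K → Bool → K}
    (h : ∀ v b, φ v b = ψ v b) : treeExpF F H T φ = treeExpF F H T ψ := by
  rw [show φ = ψ from funext fun v => funext fun b => h v b]

omit [IsStrictOrderedRing K] in
/-- The first marginal of the joint law is the law of `ŝ_T` (`treeExp`). -/
theorem treeExpF_marg (F H : Finset K) : ∀ (T : STree K) (f : K → K),
    treeExpF F H T (fun v _ => f v) = treeExp F T f
  | .leaf x, f => rfl
  | .node l r, f => by
      simp only [treeExpF, treeExp]
      rw [treeExpF_marg F H l]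
      exact treeExp_congr F l (fun a => treeExpF_marg F H r _)

omit [IsStrictOrderedRing K] in
/-- Total mass one (joint law). -/
theorem treeExpF_const (F H : Finset K) (T : STree K) (a : K) :
    treeExpF F H T (fun _ _ => a) = a := by
  rw [treeExpF_marg F H T (fun _ => a), treeExp_const]

omit [IsStrictOrderedRing K] in
/-- Additivity (joint law). -/
theorem treeExpF_add (F H : Finset K) : ∀ (T : STree K) (φ ψ : K → Bool → K),
    treeExpF F H T (fun v b => φ v b + ψ v b) = treeExpF F H T φ + treeExpF F H T ψ
  | .leaf x, φ, ψ => rfl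
  | .node l r, φ, ψ => by
      simp only [treeExpF]
      rw [← treeExpF_add F H l]
      refine treeExpF_congr F H l (fun a fa => ?_)
      rw [← treeExpF_add F H r]
      exact treeExpF_congr F H r (fun b fb => step_add F _ _ _)

omit [IsStrictOrderedRing K] in
/-- Scalars (joint law). -/
theorem treeExpF_mul_left (F H : Finset K) : ∀ (T : STree K) (a : K) (φ : K → Bool → K),
    treeExpF F H T (fun v b => a * φ v b) = a * treeExpF F H T φ
  | .leaf x, a, φ => rfl
  | .node l r, a, φ => by
      simp only [treeExpF]
      rw [← treeExpF_mul_left F H l]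
      refine treeExpF_congr F H l (fun a' fa => ?_)
      rw [← treeExpF_mul_left F H r]
      exact treeExpF_congr F H r (fun b fb => step_mul_left F _ a _)

/-- Monotonicity (joint law). -/
theorem treeExpF_mono (F H : Finset K) : ∀ (T : STree K) {φ ψ : K → Bool → K},
    (∀ v b, φ v b ≤ ψ v b) → treeExpF F H T φ ≤ treeExpF F H T ψ
  | .leaf x, _, _, h => h x false
  | .node l r, _, _, h =>
      treeExpF_mono F H l (fun _ _ => treeExpF_mono F H r (fun _ _ => step_mono F _ (fun _ => h _ _)))

/-- Positivity (joint law). -/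
theorem treeExpF_nonneg (F H : Finset K) (T : STree K) {φ : K → Bool → K} (h : ∀ v b, 0 ≤ φ v b) :
    0 ≤ treeExpF F H T φ := by
  have := treeExpF_mono F H T (φ := fun _ _ => (0 : K)) (ψ := φ) h
  rwa [treeExpF_const] at this

/-- An integrand bounded by `M` has joint expectation `≤ M`. -/
theorem treeExpF_le (F H : Finset K) (T : STree K) {φ : K → Bool → K} {M : K}
    (h : ∀ v b, φ v b ≤ M) : treeExpF F H T φ ≤ M := by
  have := treeExpF_mono F H T (φ := φ) (ψ := fun _ _ => M) h
  rwa [treeExpF_const] at this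

/-! ### The coupling identity -/

omit [IsStrictOrderedRing K] in
/-- One node of the coupling: the flagged integrand factors through "`fb` first". -/
theorem step_flag_eq (F H : Finset K) (φ : K → K) (a b : K) (fa fb : Bool) :
    step F (a + b) (fun v => if (fa || fb || outB H (a + b)) then 0 else φ v)
      = if fb then 0 else (if (fa || outB H (a + b)) then 0 else step F (a + b) φ) := by
  cases fa <;> cases fb <;> cases hO : outB H (a + b) <;> simp [step_const]

omit [IsStrictOrderedRing K] in
/-- **COUPLING IDENTITY.** If one SR step into `F₁` and into `F₂` agree at every pre-rounding value in
the hull of `H`, then for every tree `T` and every observable `φ` the two evaluations agree ON THE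
NO-EXIT EVENT: `E_{F₁}[φ(ŝ_T); no node left the hull of H] = E_{F₂}[φ(ŝ_T); same event]`. (Both
evaluations realise the same branch until the first exit; after it the integrand is `0`.) -/
theorem treeExpF_restrict_eq (F₁ F₂ H : Finset K)
    (hagree : ∀ c, InHull H c → ∀ f : K → K, step F₁ c f = step F₂ c f) :
    ∀ (T : STree K) (φ : K → K),
      treeExpF F₁ H T (fun v fl => if fl then 0 else φ v)
        = treeExpF F₂ H T (fun v fl => if fl then 0 else φ v)
  | .leaf x, φ => rfl
  | .node l r, φ => by
      simp only [treeExpF]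
      -- the node integrand with `step Fi`, as a function of the flags
      have hnode : ∀ (Fi : Finset K) (a : K) (fa : Bool),
          treeExpF Fi H r (fun b fb => step Fi (a + b)
              (fun v => if (fa || fb || outB H (a + b)) then 0 else φ v))
            = treeExpF Fi H r (fun b fb => if fb then 0 else
                (if (fa || outB H (a + b)) then 0 else step Fi (a + b) φ)) :=
        fun Fi a fa => treeExpF_congr Fi H r (fun b fb => step_flag_eq Fi H φ a b fa fb)
      -- the inner observable does not depend on `i` on the hull of `H`
      have hψ : ∀ (a : K) (fa : Bool) (b : K),
          (if (fa || outB H (a + b)) then 0 else step F₁ (a + b) φ)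
            = (if (fa || outB H (a + b)) then 0 else step F₂ (a + b) φ) := by
        intro a fa b
        cases fa
        · by_cases hin : InHull H (a + b)
          · have hO : outB H (a + b) = false := (outB_eq_false_iff H _).mpr hin
            simp [hO, hagree _ hin]
          · have hO : outB H (a + b) = true := (outB_eq_true_iff H _).mpr hin
            simp [hO]
        · simp
      -- inner subtree: induction hypothesis on `r`, then swap the step
      have hinner : ∀ (a : K) (fa : Bool),
          treeExpF F₁ H r (fun b fb => step F₁ (a + b)
              (fun v => if (fa || fb || outB H (a + b)) then 0 else φ v))
            = treeExpF F₂ H r (fun b fb => step F₂ (a + b)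
              (fun v => if (fa || fb || outB H (a + b)) then 0 else φ v)) := by
        intro a fa
        rw [hnode F₁ a fa, hnode F₂ a fa,
          treeExpF_restrict_eq F₁ F₂ H hagree r (fun b => if (fa || outB H (a + b)) then 0
            else step F₁ (a + b) φ)]
        exact treeExpF_congr F₂ H r (fun b fb => by rw [hψ a fa b])
      rw [show (fun a fa => treeExpF F₁ H r (fun b fb => step F₁ (a + b)
              (fun v => if (fa || fb || outB H (a + b)) then 0 else φ v)))
          = (fun a fa => treeExpF F₂ H r (fun b fb => step F₂ (a + b)
              (fun v => if (fa || fb || outB H (a + b)) then 0 else φ v)))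
          from funext fun a => funext fun fa => hinner a fa]
      -- outer subtree: a raised flag kills the integrand, so it has the restricted shape
      have hshape : ∀ (a : K) (fa : Bool),
          treeExpF F₂ H r (fun b fb => step F₂ (a + b)
              (fun v => if (fa || fb || outB H (a + b)) then 0 else φ v))
            = if fa then 0 else treeExpF F₂ H r (fun b fb => step F₂ (a + b)
              (fun v => if (false || fb || outB H (a + b)) then 0 else φ v)) := by
        intro a fa
        cases fa
        · simp
        · simp [step_const, treeExpF_const]
      rw [treeExpF_congr F₁ H l hshape, treeExpF_congr F₂ H l hshape]
      exact treeExpF_restrict_eq F₁ F₂ H hagree l _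

/-! ### Exit and saturation probabilities; the union bound -/

/-- Indicator of "outside the hull of `H`" (as an element of `K`). -/
def outInd (H : Finset K) (c : K) : K := if InHull H c then 0 else 1

/-- `exitProb F H T`: probability that, evaluating `T` with roundings in `F`, some node's pre-rounding
value leaves the hull of `H`. -/
def exitProb (F H : Finset K) (T : STree K) : K := treeExpF F H T (fun _ fl => if fl then 1 else 0)

/-- **`satProbT F T`: the probability that the saturating SR evaluation of `T` in the format `F`
SATURATES somewhere** (some node's exact pre-rounding sum lies outside `[min F, max F]`). -/
def satProbT (F : Finset K) (T : STree K) : K := exitProb F F T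

/-- `satProb F' H T = ∑_{nodes v = (l, r)} P_{F'}(ŝ_l + ŝ_r ∉ hull H)`: the expected NUMBER of exits
(union bound), a sum of ordinary `treeExp`-probabilities of the marginal laws. -/
def satProb (F' H : Finset K) : STree K → K
  | .leaf _ => 0
  | .node l r => satProb F' H l + satProb F' H r
      + treeExp F' l (fun a => treeExp F' r (fun b => outInd H (a + b)))

/-- Exit probabilities are nonnegative. -/
theorem exitProb_nonneg (F H : Finset K) (T : STree K) : 0 ≤ exitProb F H T :=
  treeExpF_nonneg F H T (fun _ b => by cases b <;> simp)

/-- Exit probabilities are at most one. -/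
theorem exitProb_le_one (F H : Finset K) (T : STree K) : exitProb F H T ≤ 1 :=
  treeExpF_le F H T (fun _ b => by cases b <;> simp)

/-- The exit indicator is nonnegative. -/
theorem outInd_nonneg (H : Finset K) (c : K) : 0 ≤ outInd H c := by
  unfold outInd; split_ifs <;> norm_num

/-- The exit indicator is at most one. -/
theorem outInd_le_one (H : Finset K) (c : K) : outInd H c ≤ 1 := by
  unfold outInd; split_ifs <;> norm_num

/-- The expected number of exits is nonnegative. -/
theorem satProb_nonneg (F' H : Finset K) : ∀ T : STree K, 0 ≤ satProb F' H T
  | .leaf _ => le_rfl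
  | .node l r => by
      simp only [satProb]
      exact add_nonneg (add_nonneg (satProb_nonneg F' H l) (satProb_nonneg F' H r))
        (treeExp_nonneg F' l (fun _ => treeExp_nonneg F' r (fun _ => outInd_nonneg H _)))

omit [IsStrictOrderedRing K] in
/-- **Coupling of the exit events**: under agreement on the hull of `H` the exit probabilities of the
`F₁`- and `F₂`-evaluations are EQUAL (the evaluations coincide up to the first exit). -/
theorem exitProb_eq_of_agree (F₁ F₂ H : Finset K)
    (hagree : ∀ c, InHull H c → ∀ f : K → K, step F₁ c f = step F₂ c f) (T : STree K) :
    exitProb F₁ H T = exitProb F₂ H T := by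
  have key := treeExpF_restrict_eq F₁ F₂ H hagree T (fun _ => 1)
  have hsplit : ∀ Fi : Finset K, exitProb Fi H T
      = 1 - treeExpF Fi H T (fun _ fl => if fl then 0 else (1 : K)) := by
    intro Fi
    have h := treeExpF_add Fi H T (fun _ fl => if fl then 1 else 0) (fun _ fl => if fl then 0 else 1)
    rw [treeExpF_congr Fi H T (ψ := fun _ _ => (1 : K)) (fun v b => by cases b <;> simp),
      treeExpF_const] at h
    unfold exitProb; rw [eq_sub_iff_add_eq]; exact h.symm
  rw [hsplit F₁, hsplit F₂, key]

omit [IsStrictOrderedRing K] in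
/-- **The saturation probability of `F` is the exit probability of any agreeing refinement `F'`.** -/
theorem satProbT_eq_exitProb {F F' : Finset K} (hA : Agrees F F') (T : STree K) :
    satProbT F T = exitProb F' F T :=
  exitProb_eq_of_agree F F' F (fun _ hc f => (step_eq_of_agrees hA hc f).symm) T

/-- **Union bound**: the exit probability is at most the expected number of exits `satProb`. -/
theorem exitProb_le_satProb (F' H : Finset K) : ∀ T : STree K, exitProb F' H T ≤ satProb F' H T
  | .leaf _ => by simp [exitProb, treeExpF, satProb]
  | .node l r => by
      have ihl := exitProb_le_satProb F' H l
      have ihr := exitProb_le_satProb F' H r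
      unfold exitProb at ihl ihr ⊢
      simp only [treeExpF, satProb]
      -- pointwise: 1{fa ∨ fb ∨ out} ≤ 1{fa} + 1{fb} + 1{out}, and the step integrates it out
      have hpt : ∀ (a : K) (fa : Bool) (b : K) (fb : Bool),
          step F' (a + b) (fun _ => if (fa || fb || outB H (a + b)) then (1 : K) else 0)
            ≤ (if fa then (1 : K) else 0) + ((if fb then (1 : K) else 0) + outInd H (a + b)) := by
        intro a fa b fb
        rw [step_const]
        unfold outInd
        cases fa <;> cases fb <;> by_cases hin : InHull H (a + b) <;>
          simp [hin, (outB_eq_true_iff H (a + b))]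
      have hlin : treeExpF F' H l (fun a fa => treeExpF F' H r (fun b fb =>
              (if fa then (1 : K) else 0) + ((if fb then (1 : K) else 0) + outInd H (a + b))))
          = treeExpF F' H l (fun _ fa => if fa then (1 : K) else 0)
            + (treeExpF F' H r (fun _ fb => if fb then (1 : K) else 0)
              + treeExp F' l (fun a => treeExp F' r (fun b => outInd H (a + b)))) := by
        have h1 : ∀ (a : K) (fa : Bool), treeExpF F' H r (fun b fb =>
              (if fa then (1 : K) else 0) + ((if fb then (1 : K) else 0) + outInd H (a + b)))
            = (if fa then (1 : K) else 0) + (treeExpF F' H r (fun _ fb => if fb then (1 : K) else 0)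
              + treeExp F' r (fun b => outInd H (a + b))) := by
          intro a fa
          rw [treeExpF_add F' H r, treeExpF_const, treeExpF_add F' H r,
            treeExpF_marg F' H r (fun b => outInd H (a + b))]
        rw [treeExpF_congr F' H l (fun a fa => h1 a fa), treeExpF_add F' H l,
          treeExpF_add F' H l, treeExpF_const,
          treeExpF_marg F' H l (fun a => treeExp F' r (fun b => outInd H (a + b)))]
      calc treeExpF F' H l (fun a fa => treeExpF F' H r (fun b fb =>
              step F' (a + b) (fun _ => if (fa || fb || outB H (a + b)) then 1 else 0)))
          ≤ treeExpF F' H l (fun a fa => treeExpF F' H r (fun b fb =>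
              (if fa then (1 : K) else 0) + ((if fb then (1 : K) else 0) + outInd H (a + b)))) :=
            treeExpF_mono F' H l (fun a fa => treeExpF_mono F' H r (fun b fb => hpt a fa b fb))
        _ ≤ satProb F' H l + satProb F' H r
            + treeExp F' l (fun a => treeExp F' r (fun b => outInd H (a + b))) := by
            rw [hlin]; linarith

/-- **Saturation is at most the expected number of exits of the refinement.** -/
theorem satProbT_le_satProb {F F' : Finset K} (hA : Agrees F F') (T : STree K) :
    satProbT F T ≤ satProb F' F T := by
  rw [satProbT_eq_exitProb hA]; exact exitProb_le_satProb F' F T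

/-- Kernel sanity check on the toy format `{0, 1, 2, 4}` with inputs `3, 1/2, 1/2` (left comb): the first
rounding of `7/2` goes up to `4` with probability `3/4`, after which `4 + 1/2` saturates; on the other
branch (`2`, then `5/2`) nothing leaves the hull. So `P(saturation) = 3/4` exactly. -/
example : satProbT ({0, 1, 2, 4} : Finset ℚ)
    (.node (.node (.leaf 3) (.leaf (1 / 2))) (.leaf (1 / 2))) = 3 / 4 := by
  decide +kernel

end Summit.Ventures.CertifiedArithmetic.LowPrec.SR
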